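import Mathlib
import Literature.NumberTheory.Automorphic.HilbertModularFormQExpansion
import Summits.Langlands.Langlands.Theorems.CapacityClassicalityHilbertIntegralOverconvergentIsCongruenceHilbertClassicalityIntSupply
import Summits.Langlands.Langlands.Theorems.CapacityClassicalityHilbertIntegralOverconvergentIsCongruenceStubIndicatorModularForm

/-!
# Seed data at the multiples of the seed weight (stub U10 of line Sketch-ideate-r1-k1)

Crux `HilbertIntegralOverconvergentIsCongruence` (stmt-Langlands-8485), line `Sketch-ideate-r1-k1`,
§ U, registered stub U10 `stub_seedData_multiple`.

Given the powers `s ^ j` (`j ≥ 1`) of a seed form `s` of weight `w₀` and level `Γ₁(𝔫₀)` — each a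
Hilbert modular form of weight `j • w₀`, not identically zero on `ℍ`, with vanishing constant term and
integer Fourier coefficients on the cone (hypothesis `hpow`) — we produce, for every `i ∈ ℤ`, seed data
for the weight `k = i • w₀`: a seed form `s₁ ∈ M_{w₁}(Γ₁(𝔫₀))` (`a₀ = 0`, `s₁ ≢ 0` on `ℍ`, integer
coefficients on the cone) and a shift form `G ∈ M_{w₁ - i • w₀}(Γ₁(𝔫₀))` (`G ≢ 0` on `ℍ`) whose
Fourier coefficients are `τ ∘ qG` for an `𝓞_E`-integral `qG : F → E` all of whose conjugate
`q`-series converge absolutely on the tube.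

Proof outline.
* `i ≥ 1`: write `i = j` with `j : ℕ`, `j ≥ 1`; take `w₁ := j • w₀`, `s₁ := s ^ j` (clauses from
  `hpow j`), and `G := 1_ℍ`, the indicator of `ℍ`, a Hilbert modular form of weight
  `0 = w₁ - i • w₀` with integer coefficients `[ν = 0]` on the cone (`stub_indicator_modularForm`).
* `i ≤ 0`: take `w₁ := w₀`, `s₁ := s` (clauses from `hpow 1`), and `G := s ^ n` with `n = 1 - i ≥ 1`,
  of weight `n • w₀ = w₁ - i • w₀` (clauses from `hpow n`).
In both cases the `E`-rational / integral / convergent coefficient data of the integer-coefficient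
form `G` are supplied by `hcm_intCoeff_data`.
-/

set_option linter.dupNamespace false

noncomputable section

namespace Summit.Langlands.Langlands.Theorems.HilbertIntegralOverconvergentIsCongruence

open MeasureTheory Complex NumberField
open Literature.NumberTheory.Automorphic Literature.NumberTheory.Automorphic.HilbertModular

/-- The point `(i, …, i)` lies in `ℍ`. -/
theorem sdm_constI_mem_halfSpace (F : Type) [Field F] [NumberField F] :
    (fun _ ↦ Complex.I : Point F) ∈ halfSpace F := fun σ ↦ by
  show 0 < Complex.I.im
  rw [Complex.I_im]
  exact one_pos

/-- The Fourier coefficients of the unit form `1_ℍ` on the cone are the integers `[ν = 0]`. -/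
theorem sdm_indicator_intCoeff (F : Type) [Field F] [NumberField F] [NumberField.IsTotallyReal F]
    [DecidableEq F] :
    ∀ ν ∈ qIndexSet F, fourierCoeff ((halfSpace F).indicator (fun _ ↦ (1 : ℂ))) ν =
      ((if ν = 0 then (1 : ℤ) else 0 : ℤ) : ℂ) := by
  obtain ⟨-, hG0, hGμ⟩ := stub_indicator_modularForm F (⊤ : Subgroup _)
  intro ν hν
  by_cases h0 : ν = 0
  · rw [h0, hG0, if_pos rfl, Int.cast_one]
  · rw [hGμ ν (mem_qIndexSet_iff.mp hν).1 h0, if_neg h0, Int.cast_zero]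

/-- Weight bookkeeping for `i ≥ 1`: `j • w₀ - (j : ℤ) • w₀ = 0`. -/
theorem sdm_weight_pos {X : Type} (w₀ : X → ℤ) (j : ℕ) :
    (j • w₀ : X → ℤ) - ((j : ℕ) : ℤ) • w₀ = 0 := by
  rw [natCast_zsmul, sub_self]

/-- Weight bookkeeping for `i ≤ 0`: `w₀ - i • w₀ = n • w₀` when `(n : ℤ) = 1 - i`. -/
theorem sdm_weight_nonpos {X : Type} (w₀ : X → ℤ) (i : ℤ) (n : ℕ) (hn : ((n : ℕ) : ℤ) = 1 - i) :
    w₀ - i • w₀ = n • w₀ := by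
  rw [← natCast_zsmul, hn, sub_zsmul, one_zsmul, sub_eq_add_neg]

/-- **stub U10 — `stub_seedData_multiple` (seed data at the multiples of the seed weight).** Given the
powers of a seed form `s` of weight `w₀` and level `Γ₁(𝔫₀)` (hypothesis `hpow`), for every `i ∈ ℤ`
there are seed data for the weight `k = i • w₀`: for `i ≥ 1` the seed `s ^ i` (weight `i • w₀`) with
the unit form `1_ℍ` as shift form (weight `0`; `stub_indicator_modularForm`), for `i ≤ 0` the seed `s`
with shift form `s ^ (1 - i)`; the `E`-rational / integral / convergent coefficient data of
integer-coefficient forms come from `hcm_intCoeff_data`. [folklore] -/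
theorem stub_seedData_multiple (F : Type) [Field F] [NumberField F] [NumberField.IsTotallyReal F]
    (𝔫₀ : Ideal (𝓞 F)) (E : Type) [Field E] [NumberField E] (τ : E →+* ℂ)
    (w₀ : (F →+* ℝ) → ℤ) (s : Point F → ℂ)
    (hpow : ∀ j : ℕ, 1 ≤ j → s ^ j ∈ modularForms (Bianchi.Gamma1 𝔫₀) (j • w₀) ∧
      (∃ z ∈ halfSpace F, (s ^ j) z ≠ 0) ∧ fourierCoeff (s ^ j) 0 = 0 ∧
      ∃ zj : F → ℤ, ∀ ν ∈ qIndexSet F, fourierCoeff (s ^ j) ν = (zj ν : ℂ))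
    (i : ℤ) :
    ∃ (w₁ : (F →+* ℝ) → ℤ) (s₁ G : Point F → ℂ),
      s₁ ∈ modularForms (Bianchi.Gamma1 𝔫₀) w₁ ∧ fourierCoeff s₁ 0 = 0 ∧ (∃ z ∈ halfSpace F, s₁ z ≠ 0) ∧
      (∃ zc₁ : F → ℤ, ∀ ν ∈ qIndexSet F, fourierCoeff s₁ ν = (zc₁ ν : ℂ)) ∧
      G ∈ modularForms (Bianchi.Gamma1 𝔫₀) (w₁ - i • w₀) ∧ (∃ z ∈ halfSpace F, G z ≠ 0) ∧
      ∃ qG : F → E, (∀ ν ∈ qIndexSet F, fourierCoeff G ν = τ (qG ν)) ∧ (∀ ν, IsIntegral ℤ (qG ν)) ∧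
        ∀ (τ' : E →+* ℂ) (y : (F →+* ℝ) → ℝ), (∀ σ, 0 < y σ) →
          Summable (fun ν : {ν : F | ∀ b : 𝓞 F, ∃ n : ℤ, Algebra.trace ℚ F (ν * b) = n} ↦
            ‖τ' (qG ν)‖ * Real.exp (-(2 * Real.pi * ∑ σ : F →+* ℝ, σ (ν : F) * y σ))) := by
  classical
  rcases le_or_gt 1 i with hi | hi
  · -- `1 ≤ i`: seed `s ^ j` with `i = j`, shift form the unit form `1_ℍ` of weight `0`
    obtain ⟨j, rfl⟩ : ∃ j : ℕ, i = ((j : ℕ) : ℤ) := ⟨i.toNat, (Int.toNat_of_nonneg (by omega)).symm⟩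
    have hj : 1 ≤ j := by exact_mod_cast hi
    obtain ⟨hmod, hne, hcusp, zj, hzj⟩ := hpow j hj
    have hGmod := (stub_indicator_modularForm F (Bianchi.Gamma1 𝔫₀)).1
    obtain ⟨qG, hqG_rat, hqG_int, hqG_arch⟩ :=
      hcm_intCoeff_data F 𝔫₀ E 0 _ hGmod (fun ν ↦ if ν = 0 then 1 else 0) (sdm_indicator_intCoeff F)
    refine ⟨j • w₀, s ^ j, (halfSpace F).indicator (fun _ ↦ (1 : ℂ)), hmod, hcusp, hne, ⟨zj, hzj⟩, ?_,
      ⟨fun _ ↦ Complex.I, sdm_constI_mem_halfSpace F, ?_⟩, qG, hqG_rat τ, hqG_int, hqG_arch⟩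
    · rw [sdm_weight_pos w₀ j]
      exact hGmod
    · rw [Set.indicator_of_mem (sdm_constI_mem_halfSpace F)]
      exact one_ne_zero
  · -- `i ≤ 0`: seed `s`, shift form `s ^ n` with `n = 1 - i ≥ 1`
    obtain ⟨n, hn⟩ : ∃ n : ℕ, ((n : ℕ) : ℤ) = 1 - i := ⟨(1 - i).toNat, Int.toNat_of_nonneg (by omega)⟩
    have hn1 : 1 ≤ n := by omega
    obtain ⟨hmod1, hne1, hcusp1, z1, hz1⟩ := hpow 1 le_rfl
    rw [pow_one, one_nsmul] at hmod1
    rw [pow_one] at hne1 hcusp1 hz1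
    obtain ⟨hmodn, hnen, -, zn, hzn⟩ := hpow n hn1
    obtain ⟨qG, hqG_rat, hqG_int, hqG_arch⟩ := hcm_intCoeff_data F 𝔫₀ E (n • w₀) (s ^ n) hmodn zn hzn
    refine ⟨w₀, s, s ^ n, hmod1, hcusp1, hne1, ⟨z1, hz1⟩, ?_, hnen, qG, hqG_rat τ, hqG_int, hqG_arch⟩
    rw [sdm_weight_nonpos w₀ i n hn]
    exact hmodn

end Summit.Langlands.Langlands.Theorems.HilbertIntegralOverconvergentIsCongruence

end
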